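import Literature.NumberTheory.EllipticCurves.FormalGroupLogSummableProofs
import HarnessLib

/-!
# Route `ClassRecordThree`, crux `SchneiderAtThree` (item 19106), BC5 rung `stub_rung_62310y1`: the KERNEL EVALUATOR,
# part 3 — the formal logarithm to third order, `log_W(z) = z + (a₁/2)z² + ((a₁² + a₂)/3)z³ + O(z⁴)`
# (cell `bsd-stepL`, seat `bsd-stepL-reg3-eng` g2; `--supports stmt-BirchSwinnertonDyer-19106`; plan
# `run/shared/lean/pub/bsd-stepL/reg3/FORMALISATION-SPEC.md` group C)

HONEST FRAMING: BSD is not proved by any of this; nothing here closes the crux or the rung leaf. Parts 1–2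
(`…Rung62310y1HeightEval`, `…HeightEvalSigma`) reduced the rung's one numerical inequality HH to `‖w − 72‖₃ ≤ 3⁻⁴` for
`w = log_Ŵ(z(Q))²/C²`; that needs `log_Ŵ(z(Q))` modulo `27`, i.e. the first THREE coefficients of the tree's `formalLog`
and a bound on the rest. The tree has `coeff 1 log_W = 1`, `ω(0) = 1`, `w(z) = z³ + O(z⁴)` and the integrality of `ω`
over `ℤ_p`; this file adds the next two coefficients, generically (Silverman AEC IV.1: `w = z³ + a₁z⁴ + (a₁² + a₂)z⁵ + ⋯`,
`ω = (1 + a₁z + (a₁² + a₂)z² + ⋯)dz`), theorems only, 0 defs, 0 facts: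

* §C1 (any commutative ring) `coeff_iterate_formalWStep` (the iterates `fᵐ(0)` have coefficients `1, a₁, a₁² + a₂` in
  degrees `3, 4, 5` once `m ≥ 1, 2, 3`), `coeff_four_formalW`, `coeff_five_formalW`, `coeff_one_formalWDivCube`,
  `coeff_two_formalWDivCube`;
* §C2 (any `ℚ`-algebra) `coeff_one_formalOmega = a₁`, `coeff_two_formalOmega = a₁² + a₂` (comparing coefficients in the
  tree's identity `formalOmega_mul_denom : ω·B(2 − a₁z − a₃z³B) = 2B + zB′`), `coeff_two_formalLog = a₁/2`,
  `coeff_three_formalLog = (a₁² + a₂)/3`;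
* §C3 (over `ℚ₃`, `p`-integral equation) `norm_coeff_formalLog_le_norm_inv` (sharp `‖coeff n log_W‖ ≤ ‖1/n‖₃`) and
  **`norm_padicFormalLog_sub_cubic_le`**: for `‖z‖₃ ≤ 3⁻¹`,
  `‖log_W(z) − (z + a₁z²/2 + (a₁² + a₂)z³/3)‖₃ ≤ 3⁻⁴` (terms `n ≥ 4`: `‖1/n‖₃·3⁻ⁿ ≤ 3⁻⁴`).

References: [SilvermanAEC2009] IV.1.1 (expansions of `w`, `ω`), IV.5.5 (`log`), IV.6.3–6.4 (convergence).
-/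

open scoped Classical

open PowerSeries Literature.NumberTheory.EllipticCurves

namespace Summit.BirchSwinnertonDyer.Rank1Residual.X11b.RegMult.Rung62310y1

/-! ### §C1 `w(z) = z³ + a₁z⁴ + (a₁² + a₂)z⁵ + O(z⁶)` -/

section Ring

variable {R : Type*} [CommRing R] (W : WeierstrassCurve R)

/-- The iterates `fᵐ(0)` of the contraction `f(w) = z³ + a₁zw + a₂z²w + a₃w² + a₄zw² + a₆w³` satisfy
`coeff 3 = 1` (`m ≥ 1`), `coeff 4 = a₁` (`m ≥ 2`), `coeff 5 = a₁² + a₂` (`m ≥ 3`). [Silverman AEC IV.1.1(a)]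
[cite: SilvermanAEC2009, IV.1.1] -/
theorem coeff_iterate_formalWStep (m : ℕ) :
    coeff 3 ((W.formalWStep)^[m + 1] 0) = 1 ∧
    (1 ≤ m → coeff 4 ((W.formalWStep)^[m + 1] 0) = W.a₁) ∧
    (2 ≤ m → coeff 5 ((W.formalWStep)^[m + 1] 0) = W.a₁ ^ 2 + W.a₂) := by
  induction m with
  | zero =>
    refine ⟨?_, fun h => absurd h (by norm_num), fun h => absurd h (by norm_num)⟩
    rw [zero_add, Function.iterate_one]
    obtain ⟨u, hu⟩ := W.X_pow_three_dvd_iterate_formalWStep 0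
    rw [Function.iterate_zero, id_eq] at hu
    rw [hu, W.formalWStep_X_pow_mul, map_add, coeff_X_pow_mul', coeff_X_pow]
    simp
  | succ k ih =>
    obtain ⟨h3, h4, h5⟩ := ih
    obtain ⟨u, hu⟩ := W.X_pow_three_dvd_iterate_formalWStep (k + 1)
    -- coefficients of `u` from those of `fᵏ⁺¹(0) = z³ u`
    have hu0 : coeff 0 u = 1 := by
      have := h3; rw [hu, coeff_X_pow_mul'] at this; simpa using this
    have hu1 : 1 ≤ k → coeff 1 u = W.a₁ := fun hk => by
      have := h4 hk; rw [hu, coeff_X_pow_mul'] at this; simpa using this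
    have hstep : (W.formalWStep)^[k + 1 + 1] 0 = W.formalWStep (X ^ 3 * u) := by
      rw [Function.iterate_succ_apply', hu]
    rw [hstep, W.formalWStep_X_pow_mul]
    refine ⟨?_, fun _ => ?_, fun hk => ?_⟩
    · rw [map_add, coeff_X_pow_mul', coeff_X_pow]; simp
    · rw [map_add, coeff_X_pow_mul', coeff_X_pow]
      simp only [show ¬ (4 : ℕ) = 3 by norm_num, if_false, show (4 : ℕ) ≤ 4 by norm_num, if_true, zero_add,
        Nat.sub_self, map_add, mul_assoc, coeff_C_mul, coeff_zero_X_mul, coeff_X_pow_mul']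
      simp [hu0]
    · rw [map_add, coeff_X_pow_mul', coeff_X_pow]
      simp only [show ¬ (5 : ℕ) = 3 by norm_num, if_false, show (4 : ℕ) ≤ 5 by norm_num, if_true, zero_add,
        show (5 : ℕ) - 4 = 1 by norm_num, map_add, mul_assoc, coeff_C_mul, coeff_succ_X_mul, coeff_X_pow_mul']
      simp [hu0, hu1 (by omega)]
      ring

/-- `coeff 4 w(z) = a₁`. [Silverman AEC IV.1.1(a)] [cite: SilvermanAEC2009, IV.1.1] -/
theorem coeff_four_formalW : coeff 4 W.formalW = W.a₁ := by
  rw [WeierstrassCurve.formalW, coeff_mk]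
  exact ((coeff_iterate_formalWStep W) 3).2.1 (by norm_num)

/-- `coeff 5 w(z) = a₁² + a₂`. [Silverman AEC IV.1.1(a)] [cite: SilvermanAEC2009, IV.1.1] -/
theorem coeff_five_formalW : coeff 5 W.formalW = W.a₁ ^ 2 + W.a₂ := by
  rw [WeierstrassCurve.formalW, coeff_mk]
  exact ((coeff_iterate_formalWStep W) 4).2.2 (by norm_num)

/-- `coeff 1 B = a₁` for `B = w/z³`. [Silverman AEC IV.1.1(a)] [cite: SilvermanAEC2009, IV.1.1] -/
theorem coeff_one_formalWDivCube : coeff 1 W.formalWDivCube = W.a₁ := by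
  rw [WeierstrassCurve.formalWDivCube, coeff_mk]; exact (coeff_four_formalW W)

/-- `coeff 2 B = a₁² + a₂` for `B = w/z³`. [Silverman AEC IV.1.1(a)] [cite: SilvermanAEC2009, IV.1.1] -/
theorem coeff_two_formalWDivCube : coeff 2 W.formalWDivCube = W.a₁ ^ 2 + W.a₂ := by
  rw [WeierstrassCurve.formalWDivCube, coeff_mk]; exact (coeff_five_formalW W)

end Ring

/-! ### §C2 `ω = (1 + a₁z + (a₁² + a₂)z² + ⋯)dz` and `log_W = z + (a₁/2)z² + ((a₁² + a₂)/3)z³ + ⋯` -/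

section RatAlgebra

variable {A : Type*} [CommRing A] [Algebra ℚ A] (W : WeierstrassCurve A)

omit [Algebra ℚ A] in
/-- Coefficients `0, 1, 2` of the denominator `D = B·(2 − a₁z − a₃z³B)` of `ω`: `2`, `a₁`, `a₁² + 2a₂`. [folklore] -/
private theorem coeff_formalOmegaDenom :
    coeff 0 (W.formalWDivCube * (2 - C W.a₁ * X - C W.a₃ * X ^ 3 * W.formalWDivCube)) = 2 ∧
    coeff 1 (W.formalWDivCube * (2 - C W.a₁ * X - C W.a₃ * X ^ 3 * W.formalWDivCube)) = W.a₁ ∧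
    coeff 2 (W.formalWDivCube * (2 - C W.a₁ * X - C W.a₃ * X ^ 3 * W.formalWDivCube)) = W.a₁ ^ 2 + 2 * W.a₂ := by
  have hD : W.formalWDivCube * (2 - C W.a₁ * X - C W.a₃ * X ^ 3 * W.formalWDivCube) =
      C (2 : A) * W.formalWDivCube - C W.a₁ * (X * W.formalWDivCube) -
        C W.a₃ * (X ^ 3 * (W.formalWDivCube * W.formalWDivCube)) := by
    rw [map_ofNat]; ring
  have h0 : coeff 0 W.formalWDivCube = 1 := by
    rw [coeff_zero_eq_constantCoeff]; exact W.constantCoeff_formalWDivCube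
  rw [hD]
  refine ⟨?_, ?_, ?_⟩
  · simp only [map_sub, coeff_C_mul, coeff_zero_X_mul, coeff_X_pow_mul', h0]; simp
  · simp only [map_sub, coeff_C_mul, coeff_succ_X_mul, coeff_X_pow_mul', h0, (coeff_one_formalWDivCube W)]
    simp; ring
  · simp only [map_sub, coeff_C_mul, coeff_succ_X_mul, coeff_X_pow_mul', (coeff_one_formalWDivCube W),
      (coeff_two_formalWDivCube W)]
    simp; ring

/-- **`coeff 1 ω = a₁`** (comparing degree-1 coefficients in `ω·D = 2B + zB′`: `a₁ + 2ω₁ = 3a₁`, `2 ∈ Aˣ`).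
[Silverman AEC IV.1 (expansion of `ω`)] [cite: SilvermanAEC2009, IV.1.1] -/
theorem coeff_one_formalOmega : coeff 1 W.formalOmega = W.a₁ := by
  have h := congrArg (coeff 1) W.formalOmega_mul_denom
  obtain ⟨d0, d1, -⟩ := (coeff_formalOmegaDenom W)
  have hω0 : coeff 0 W.formalOmega = 1 := by
    rw [coeff_zero_eq_constantCoeff]; exact W.constantCoeff_formalOmega
  rw [PowerSeries.coeff_mul, Finset.Nat.sum_antidiagonal_succ] at h
  simp only [Finset.Nat.antidiagonal_zero, Finset.sum_singleton, zero_add] at h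
  rw [hω0, d1, d0, map_add, show (2 : A⟦X⟧) * W.formalWDivCube = C (2 : A) * W.formalWDivCube by rw [map_ofNat],
    coeff_C_mul, (coeff_one_formalWDivCube W), coeff_succ_X_mul, coeff_derivative, (coeff_one_formalWDivCube W)] at h
  -- `h : 1 * a₁ + ω₁ * 2 = 2 * a₁ + a₁ * (0 + 1)`
  have h2 : IsUnit (2 : A) := ⟨WeierstrassCurve.unitTwo, rfl⟩
  refine h2.mul_left_cancel ?_
  have : (2 : A) * coeff 1 W.formalOmega = coeff 1 W.formalOmega * 2 := mul_comm _ _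
  rw [this]
  push_cast at h
  linear_combination h

/-- **`coeff 2 ω = a₁² + a₂`** (degree-2 coefficients in `ω·D = 2B + zB′`). [Silverman AEC IV.1 (expansion of `ω`)]
[cite: SilvermanAEC2009, IV.1.1] -/
theorem coeff_two_formalOmega : coeff 2 W.formalOmega = W.a₁ ^ 2 + W.a₂ := by
  have h := congrArg (coeff 2) W.formalOmega_mul_denom
  obtain ⟨d0, d1, d2⟩ := (coeff_formalOmegaDenom W)
  have hω0 : coeff 0 W.formalOmega = 1 := by
    rw [coeff_zero_eq_constantCoeff]; exact W.constantCoeff_formalOmega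
  have hω1 := (coeff_one_formalOmega W)
  rw [PowerSeries.coeff_mul, Finset.Nat.sum_antidiagonal_succ, Finset.Nat.sum_antidiagonal_succ] at h
  simp only [Finset.Nat.antidiagonal_zero, Finset.sum_singleton, zero_add] at h
  rw [hω0, hω1, d2, d1, d0, map_add, show (2 : A⟦X⟧) * W.formalWDivCube = C (2 : A) * W.formalWDivCube by
      rw [map_ofNat], coeff_C_mul, (coeff_two_formalWDivCube W), coeff_succ_X_mul, coeff_derivative,
    (coeff_two_formalWDivCube W)] at h
  have h2 : IsUnit (2 : A) := ⟨WeierstrassCurve.unitTwo, rfl⟩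
  refine h2.mul_left_cancel ?_
  have : (2 : A) * coeff 2 W.formalOmega = coeff 2 W.formalOmega * 2 := mul_comm _ _
  rw [this]
  push_cast at h
  linear_combination h

/-- **`coeff 2 log_W = a₁/2`** (`log_W = ∫ ω`). [Silverman AEC IV.5.5] [cite: SilvermanAEC2009, IV.5.5] -/
theorem coeff_two_formalLog : coeff 2 W.formalLog = algebraMap ℚ A (1 / 2) * W.a₁ := by
  rw [WeierstrassCurve.formalLog, coeff_mk]
  show algebraMap ℚ A (1 / ((0 : ℕ) + 2 : ℚ)) * coeff (0 + 1) W.formalOmega = _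
  rw [(coeff_one_formalOmega W)]; norm_num

/-- **`coeff 3 log_W = (a₁² + a₂)/3`**. [Silverman AEC IV.5.5] [cite: SilvermanAEC2009, IV.5.5] -/
theorem coeff_three_formalLog : coeff 3 W.formalLog = algebraMap ℚ A (1 / 3) * (W.a₁ ^ 2 + W.a₂) := by
  rw [WeierstrassCurve.formalLog, coeff_mk]
  show algebraMap ℚ A (1 / ((1 : ℕ) + 2 : ℚ)) * coeff (1 + 1) W.formalOmega = _
  rw [(coeff_two_formalOmega W)]; norm_num

end RatAlgebra

/-! ### §C3 Over `ℚ₃`: `log_W(z)` modulo `O(3⁻⁴)` for `‖z‖ ≤ 3⁻¹` -/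

section Padic

variable (V : WeierstrassCurve ℚ_[3]) [V.IsIntegral ℤ_[3]]

/-- Sharp form of the tree's `norm_coeff_formalLog_le`: `‖coeff (n+2) log_W‖₃ ≤ ‖1/(n+2)‖₃` (`ω ∈ ℤ₃⟦z⟧`).
[Silverman AEC IV.5.5, IV.6.3] [cite: SilvermanAEC2009, IV.6.3] -/
theorem norm_coeff_formalLog_le_norm_inv (n : ℕ) :
    ‖coeff (n + 2) V.formalLog‖ ≤ ‖(((n + 2 : ℕ) : ℚ_[3]))⁻¹‖ := by
  rw [WeierstrassCurve.formalLog, coeff_mk]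
  dsimp only
  rw [norm_mul, map_div₀, map_one, one_div]
  have h1 : (algebraMap ℚ ℚ_[3] (n + 2 : ℚ)) = ((n + 2 : ℕ) : ℚ_[3]) := by
    rw [map_add, map_natCast, map_ofNat]; push_cast; ring
  rw [h1]
  have h2 : ‖coeff (n + 1) V.formalOmega‖ ≤ 1 := isPadicInt_iff_coeff.mp V.isPadicInt_formalOmega _
  calc ‖(((n + 2 : ℕ) : ℚ_[3]))⁻¹‖ * ‖coeff (n + 1) V.formalOmega‖ ≤ ‖(((n + 2 : ℕ) : ℚ_[3]))⁻¹‖ * 1 := by gcongr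
    _ = _ := mul_one _

/-- `81·m ≤ 3ᵐ` for `m ≥ 6`. [folklore] -/
private theorem eightyone_mul_le_pow {m : ℕ} (hm : 6 ≤ m) : 81 * m ≤ 3 ^ m := by
  induction m with
  | zero => omega
  | succ k ih =>
    rcases Nat.lt_or_ge k 6 with hk | hk
    · obtain rfl : k = 5 := by omega
      norm_num
    · have h81 : 81 ≤ 3 ^ k := le_trans (by norm_num : 81 ≤ 3 ^ 6) (Nat.pow_le_pow_right (by norm_num) hk)
      calc 81 * (k + 1) = 81 * k + 81 := by ring
        _ ≤ 3 ^ k + 3 ^ k := Nat.add_le_add (ih hk) h81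
        _ ≤ 3 ^ (k + 1) := by rw [pow_succ]; omega

/-- The terms of degree `≥ 4` of `log_W(z)` have norm `≤ 3⁻⁴` for `‖z‖₃ ≤ 3⁻¹` (`‖1/n‖₃·3⁻ⁿ ≤ 3⁻⁴`: `n = 4, 5` are
`3`-adic units, and `‖1/n‖₃ ≤ n ≤ 3ⁿ/81` for `n ≥ 6`). [Silverman AEC IV.6.3] [cite: SilvermanAEC2009, IV.6.3] -/
private theorem norm_formalLog_term_le {z : ℚ_[3]} (hz : ‖z‖ ≤ 1 / 3) (n : ℕ) :
    ‖coeff (n + 4) V.formalLog * z ^ (n + 4)‖ ≤ 1 / 81 := by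
  rw [norm_mul, norm_pow]
  have hc := (norm_coeff_formalLog_le_norm_inv V) (n + 2)
  rw [show n + 2 + 2 = n + 4 by ring] at hc
  have hzn : ‖z‖ ^ (n + 4) ≤ (1 / 3 : ℝ) ^ (n + 4) := by gcongr
  rcases Nat.lt_or_ge n 2 with hn | hn
  · -- `n + 4 ∈ {4, 5}`: `3 ∤ n + 4`
    have hunit : ‖(((n + 4 : ℕ) : ℚ_[3]))⁻¹‖ = 1 := by
      rw [norm_inv, Padic.norm_eq_zpow_neg_valuation (by exact_mod_cast (show (n + 4 : ℕ) ≠ 0 by omega)),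
        Padic.valuation_natCast,
        padicValNat.eq_zero_of_not_dvd (by interval_cases n <;> norm_num)]
      simp
    calc ‖coeff (n + 4) V.formalLog‖ * ‖z‖ ^ (n + 4) ≤ 1 * (1 / 3 : ℝ) ^ (n + 4) := by
          gcongr; exact hc.trans hunit.le
      _ ≤ 1 * (1 / 3 : ℝ) ^ 4 :=
          mul_le_mul_of_nonneg_left (pow_le_pow_of_le_one (by norm_num) (by norm_num) (by omega)) (by norm_num)
      _ = 1 / 81 := by norm_num
  · have hm : ‖(((n + 4 : ℕ) : ℚ_[3]))⁻¹‖ ≤ ((n + 4 : ℕ) : ℝ) := padic_norm_inv_natCast_le (n + 4)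
    have hpow := eightyone_mul_le_pow (show 6 ≤ n + 4 by omega)
    have hpow' : (81 : ℝ) * ((n + 4 : ℕ) : ℝ) ≤ (3 : ℝ) ^ (n + 4) := by exact_mod_cast hpow
    calc ‖coeff (n + 4) V.formalLog‖ * ‖z‖ ^ (n + 4) ≤ ((n + 4 : ℕ) : ℝ) * (1 / 3 : ℝ) ^ (n + 4) := by
          gcongr; exact hc.trans hm
      _ = ((n + 4 : ℕ) : ℝ) / (3 : ℝ) ^ (n + 4) := by rw [one_div, inv_pow]; ring
      _ ≤ 1 / 81 := by
          rw [div_le_div_iff₀ (by positivity) (by norm_num)]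
          linarith

/-- **`log_W(z) = z + (a₁/2)z² + ((a₁² + a₂)/3)z³ + O(3⁻⁴)` on `‖z‖₃ ≤ 3⁻¹`** for a `3`-integral equation over `ℚ₃`:
`‖padicFormalLog W z − (z + 2⁻¹a₁z² + 3⁻¹(a₁² + a₂)z³)‖₃ ≤ 3⁻⁴` (first four terms explicit, tail by the ultrametric
`tsum` bound). [Silverman AEC IV.5.5, IV.6.4] [cite: SilvermanAEC2009, IV.6.4] -/
theorem norm_padicFormalLog_sub_cubic_le {z : ℚ_[3]} (hz : ‖z‖ ≤ 1 / 3) :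
    ‖V.padicFormalLog z - (z + (2 : ℚ_[3])⁻¹ * V.a₁ * z ^ 2 + (3 : ℚ_[3])⁻¹ * (V.a₁ ^ 2 + V.a₂) * z ^ 3)‖ ≤ 1 / 81 := by
  have hs := V.summable_formalLog_of_isIntegral z (hz.trans_lt (by norm_num))
  have hsplit := hs.sum_add_tsum_nat_add 4
  have h0 : coeff 0 V.formalLog = 0 := by rw [coeff_zero_eq_constantCoeff]; exact V.constantCoeff_formalLog
  have h2 : coeff 2 V.formalLog = (2 : ℚ_[3])⁻¹ * V.a₁ := by
    rw [(coeff_two_formalLog V), eq_ratCast]; push_cast; ring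
  have h3 : coeff 3 V.formalLog = (3 : ℚ_[3])⁻¹ * (V.a₁ ^ 2 + V.a₂) := by
    rw [(coeff_three_formalLog V), eq_ratCast]; push_cast; ring
  have hfour : ∑ i ∈ Finset.range 4, coeff i V.formalLog * z ^ i =
      z + (2 : ℚ_[3])⁻¹ * V.a₁ * z ^ 2 + (3 : ℚ_[3])⁻¹ * (V.a₁ ^ 2 + V.a₂) * z ^ 3 := by
    simp only [Finset.sum_range_succ, Finset.sum_range_zero, h0, V.coeff_one_formalLog, h2, h3]
    ring
  rw [WeierstrassCurve.padicFormalLog, ← hsplit, hfour, add_sub_cancel_left]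
  exact IsUltrametricDist.norm_tsum_le_of_forall_le_of_nonneg (by norm_num) fun n ↦ (norm_formalLog_term_le V) hz n

end Padic

end Summit.BirchSwinnertonDyer.Rank1Residual.X11b.RegMult.Rung62310y1
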